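import Summits.AtomisticToContinuum.HydrodynamicLimit.Theorems.InformationPercolationEngineChaosClosesEulerReductionTransport
import Summits.AtomisticToContinuum.HydrodynamicLimit.Theorems.InformationPercolationEngineChaosClosesEulerReductionStrip
import HarnessLib

/-!
# Kinetic reduction (crux `ChaosClosesEuler`, stmt-AtomisticToContinuum-15141, line `Sketch`,
# stub `stub_kineticReduction`) — helper: removing the time shift from the momentum residual

WHAT. The momentum residual (H2) of the BF18 shell is written with the classical velocity `ũ(s)` itself, whereas the
exact weak equation is tested with the SHIFTED field `ũ(s + e)` (smooth on all of space–time after cutting off).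
Along ONE good orbit the two residuals differ by at most
`ω [(1 + 2 ke) + b ((7 + 2B) ke + 1/2)]` uniformly in `τ ∈ [0, b]`, where `ω` bounds the shift differences
`ũ(s+e) − ũ(s)`, `∂ₜũ(s+e) − ∂ₜũ(s)`, `∂ⱼũᵢ(s+e) − ∂ⱼũᵢ(s)` on `[0, b] × 𝕋³` and `B` bounds `|χ|` (`shift_error`): every
integrand in the difference is kinetically dominated with constants proportional to `ω` (helper `ReductionTransport`).

No named fact is invoked.
-/

noncomputable section

namespace Summit.AtomisticToContinuum.HydrodynamicLimit.Theorems.ChaosClosesEulerReduction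

open scoped BigOperators Topology Classical MeasureTheory ENNReal InnerProductSpace
open Filter Set MeasureTheory Function
open Literature.MathematicalPhysics.KineticTheory
open Literature.Analysis.FluidPDE
open Literature.Analysis.FunctionSpaces
open Summit.AtomisticToContinuum.HydrodynamicLimit.Theorems.LocalSecondLawNegative
open Summit.AtomisticToContinuum.HydrodynamicLimit.Theorems.LocalSecondLawLedger

variable {N : ℕ}

/-! ## §1 The flux integrand: measurability recipe and domination of shift differences -/

/-- **The flux integrand of (H2) is a.e. measurable whenever its factors are.** [folklore] -/
theorem aemeasurable_flux_recipe {α : Type*} [MeasurableSpace α] {ν : Measure α} {Ut m : α → V3}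
    {D : Fin 3 → Fin 3 → α → ℝ} {ρ θc χρ : α → ℝ}
    (hUt : AEMeasurable Ut ν) (hm : AEMeasurable m ν) (hD : ∀ i j, AEMeasurable (D i j) ν)
    (hρ : AEMeasurable ρ ν) (hθ : AEMeasurable θc ν) (hχ : AEMeasurable χρ ν) :
    AEMeasurable (fun a => ⟪Ut a, m a⟫_ℝ +
      ∑ i : Fin 3, ∑ j : Fin 3, D i j a * (m a i * m a j / ρ a + if i = j then ρ a * θc a * χρ a else 0)) ν := by
  have hmk : ∀ k, AEMeasurable (fun a => m a k) ν := fun k =>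
    (EuclideanSpace.proj k : V3 →L[ℝ] ℝ).continuous.measurable.comp_aemeasurable hm
  refine (hUt.inner hm).add (Finset.aemeasurable_fun_sum _ fun i _ => Finset.aemeasurable_fun_sum _ fun j _ => ?_)
  refine (hD i j).mul ((((hmk i).mul (hmk j)).div hρ).add ?_)
  by_cases h : i = j
  · simp only [h, if_true]; exact (hρ.mul hθ).mul hχ
  · simp only [h, if_false]; exact aemeasurable_const

/-- **Domination of the difference of two flux integrands** (two velocity data at the same point):
`|⟪t₁ − t₂, m_r⟫ + ∑ (D₁ − D₂)ᵢⱼ (mᵢmⱼ/ρ_r + δᵢⱼ p_V)| ≤ ω(7 + 2B) e_r + (ω/2) ρ_r` when `‖t₁ − t₂‖ ≤ ω`, `|D₁ − D₂| ≤ ω`.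
[folklore] -/
theorem abs_flux_sub_le {r : ℝ} (hr : 0 < r) (w : Phase N) (x : T3) {ω B : ℝ} (hω : 0 ≤ ω) (hB0 : 0 ≤ B)
    {t₁ t₂ : V3} (ht : ‖t₁ - t₂‖ ≤ ω) {D₁ D₂ : Fin 3 → Fin 3 → ℝ} (hD : ∀ i j, |D₁ i j - D₂ i j| ≤ ω)
    {χe : ℝ → ℝ} (hB : ∀ a, 0 < a → |χe a| ≤ B) :
    |(⟪t₁, momC r w x⟫_ℝ + ∑ i : Fin 3, ∑ j : Fin 3, D₁ i j * (momC r w x i * momC r w x j / rhoC r w x +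
        if i = j then rhoC r w x * thetaC r w x * χe (rhoC r w x) else 0)) -
      (⟪t₂, momC r w x⟫_ℝ + ∑ i : Fin 3, ∑ j : Fin 3, D₂ i j * (momC r w x i * momC r w x j / rhoC r w x +
        if i = j then rhoC r w x * thetaC r w x * χe (rhoC r w x) else 0))| ≤
      0 + ω * (7 + 2 * B) * kinC r w x + ω / 2 * rhoC r w x := by
  -- rewrite the difference as one flux integrand with data `(t₁ − t₂, D₁ − D₂)`
  have heq : (⟪t₁, momC r w x⟫_ℝ + ∑ i : Fin 3, ∑ j : Fin 3, D₁ i j * (momC r w x i * momC r w x j / rhoC r w x +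
        if i = j then rhoC r w x * thetaC r w x * χe (rhoC r w x) else 0)) -
      (⟪t₂, momC r w x⟫_ℝ + ∑ i : Fin 3, ∑ j : Fin 3, D₂ i j * (momC r w x i * momC r w x j / rhoC r w x +
        if i = j then rhoC r w x * thetaC r w x * χe (rhoC r w x) else 0)) =
      ⟪t₁ - t₂, momC r w x⟫_ℝ + ∑ i : Fin 3, ∑ j : Fin 3, (D₁ i j - D₂ i j) * (momC r w x i * momC r w x j / rhoC r w x +
        if i = j then rhoC r w x * thetaC r w x * χe (rhoC r w x) else 0) := by
    rw [inner_sub_left]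
    have h : ∑ i : Fin 3, ∑ j : Fin 3, (D₁ i j - D₂ i j) * (momC r w x i * momC r w x j / rhoC r w x +
        if i = j then rhoC r w x * thetaC r w x * χe (rhoC r w x) else 0) =
        (∑ i : Fin 3, ∑ j : Fin 3, D₁ i j * (momC r w x i * momC r w x j / rhoC r w x +
          if i = j then rhoC r w x * thetaC r w x * χe (rhoC r w x) else 0)) -
        ∑ i : Fin 3, ∑ j : Fin 3, D₂ i j * (momC r w x i * momC r w x j / rhoC r w x +
          if i = j then rhoC r w x * thetaC r w x * χe (rhoC r w x) else 0) := by
      rw [← Finset.sum_sub_distrib]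
      refine Finset.sum_congr rfl fun i _ => ?_
      rw [← Finset.sum_sub_distrib]
      refine Finset.sum_congr rfl fun j _ => by ring
    rw [h]; ring
  rw [heq]
  -- the inner product term
  have h1 : |⟪t₁ - t₂, momC r w x⟫_ℝ| ≤ ω * (rhoC r w x / 2 + kinC r w x) := by
    have ha : |⟪t₁ - t₂, momC r w x⟫_ℝ| ≤ ‖t₁ - t₂‖ * ‖momC r w x‖ := abs_real_inner_le_norm _ _
    exact ha.trans (mul_le_mul ht (norm_momC_le_half hr w x) (norm_nonneg _) hω)
  -- the flux term, split into the quadratic part and the pressure part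
  have hsplit : ∑ i : Fin 3, ∑ j : Fin 3, (D₁ i j - D₂ i j) * (momC r w x i * momC r w x j / rhoC r w x +
      if i = j then rhoC r w x * thetaC r w x * χe (rhoC r w x) else 0) =
      (∑ i : Fin 3, ∑ j : Fin 3, (D₁ i j - D₂ i j) * (momC r w x i * momC r w x j / rhoC r w x)) +
      (∑ k : Fin 3, (D₁ k k - D₂ k k)) * (rhoC r w x * thetaC r w x * χe (rhoC r w x)) := by
    have h2 : ∑ i : Fin 3, ∑ j : Fin 3, (D₁ i j - D₂ i j) * (if i = j then rhoC r w x * thetaC r w x * χe (rhoC r w x) else 0) =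
        (∑ k : Fin 3, (D₁ k k - D₂ k k)) * (rhoC r w x * thetaC r w x * χe (rhoC r w x)) := by
      rw [Finset.sum_mul]
      refine Finset.sum_congr rfl fun i _ => ?_
      rw [Finset.sum_eq_single i (fun j _ hji => by rw [if_neg (Ne.symm hji), mul_zero])
        (fun h => absurd (Finset.mem_univ i) h), if_pos rfl]
    rw [← h2, ← Finset.sum_add_distrib]
    refine Finset.sum_congr rfl fun i _ => ?_
    rw [← Finset.sum_add_distrib]
    refine Finset.sum_congr rfl fun j _ => by ring
  have hA : |∑ i : Fin 3, ∑ j : Fin 3, (D₁ i j - D₂ i j) * (momC r w x i * momC r w x j / rhoC r w x)| ≤ ω * (6 * kinC r w x) :=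
    (abs_sum_sum_mul_le hD).trans (mul_le_mul_of_nonneg_left (sum_abs_mm_div_le hr w x) hω)
  have htr : |∑ k : Fin 3, (D₁ k k - D₂ k k)| ≤ 3 * ω := by
    calc _ ≤ ∑ k : Fin 3, |D₁ k k - D₂ k k| := Finset.abs_sum_le_sum_abs _ _
      _ ≤ ∑ _k : Fin 3, ω := Finset.sum_le_sum fun k _ => hD k k
      _ = 3 * ω := by simp [Finset.sum_const, Finset.card_univ]
  have hB' : |(∑ k : Fin 3, (D₁ k k - D₂ k k)) * (rhoC r w x * thetaC r w x * χe (rhoC r w x))| ≤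
      3 * ω * (2 / 3 * B * kinC r w x) := by
    rw [abs_mul]; exact mul_le_mul htr (abs_pV_le hr w x hB0 hB) (abs_nonneg _) (by positivity)
  have h2 : |∑ i : Fin 3, ∑ j : Fin 3, (D₁ i j - D₂ i j) * (momC r w x i * momC r w x j / rhoC r w x +
      if i = j then rhoC r w x * thetaC r w x * χe (rhoC r w x) else 0)| ≤ ω * (6 + 2 * B) * kinC r w x := by
    rw [hsplit]
    calc _ ≤ _ := abs_add_le _ _
      _ ≤ ω * (6 * kinC r w x) + 3 * ω * (2 / 3 * B * kinC r w x) := add_le_add hA hB'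
      _ = ω * (6 + 2 * B) * kinC r w x := by ring
  calc _ ≤ |⟪t₁ - t₂, momC r w x⟫_ℝ| + _ := abs_add_le _ _
    _ ≤ ω * (rhoC r w x / 2 + kinC r w x) + ω * (6 + 2 * B) * kinC r w x := add_le_add h1 h2
    _ = 0 + ω * (7 + 2 * B) * kinC r w x + ω / 2 * rhoC r w x := by ring

/-! ## §2 The pairing at one instant -/

/-- `|∫⟪a − b, m_r⟫| ≤ ω (1/2 + ke)` for continuous `a, b` with `‖a − b‖ ≤ ω` (`r < 1/2`). [folklore] -/
theorem abs_integral_inner_sub_le {r : ℝ} (hr : 0 < r) (hr2 : r < 1 / 2) (w : Phase N) {a b : T3 → V3}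
    (ha : Continuous a) (hb : Continuous b) {ω : ℝ} (hω : 0 ≤ ω) (hab : ∀ x, ‖a x - b x‖ ≤ ω) :
    |(∫ x, ⟪a x, momC r w x⟫_ℝ) - ∫ x, ⟪b x, momC r w x⟫_ℝ| ≤ ω * (1 / 2 + ke w) := by
  have hm : Continuous (momC r w) := continuous_momC r w
  have hia : Integrable (fun x => ⟪a x, momC r w x⟫_ℝ) volume := (ha.inner hm).integrable_unitAddTorus
  have hib : Integrable (fun x => ⟪b x, momC r w x⟫_ℝ) volume := (hb.inner hm).integrable_unitAddTorus
  rw [← integral_sub hia hib]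
  have hpt : ∀ x, ‖⟪a x, momC r w x⟫_ℝ - ⟪b x, momC r w x⟫_ℝ‖ ≤ ω * ‖momC r w x‖ := fun x => by
    rw [← inner_sub_left, Real.norm_eq_abs]
    exact (abs_real_inner_le_norm _ _).trans (mul_le_mul_of_nonneg_right (hab x) (norm_nonneg _))
  calc _ ≤ ∫ x, ω * ‖momC r w x‖ := by
        rw [← Real.norm_eq_abs]
        exact norm_integral_le_of_norm_le ((hm.norm.const_mul ω).integrable_unitAddTorus) (ae_of_all _ hpt)
    _ = ω * ∫ x, ‖momC r w x‖ := integral_const_mul _ _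
    _ ≤ ω * (1 / 2 + ke w) := mul_le_mul_of_nonneg_left (integral_norm_momC_le hr hr2 w) hω

/-! ## §3 The shift error of the momentum residual -/

set_option maxHeartbeats 800000 in
/-- **Removing the time shift.** Along a good orbit, for `0 ≤ e`, `0 ≤ b`, `b + e < T`, `χ` continuous on `(0, ∞)`
with `|χ| ≤ B`, and a bound `ω` of the three shift differences on `[0, b] × 𝕋³`, the momentum residual of (H2)
(velocity `ũ(s)`) and the shifted one (velocity `ũ(s+e)`) differ, for every `τ ∈ [0, b]`, by at most
`ω ((1 + 2 ke) + b ((7 + 2B) ke + 1/2))`. [folklore] -/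
theorem shift_error {σ : ℝ} (Φ : HardSphereFlow (Torus.geometry (Fin 3)) (hsDiameter σ N) (N + 1))
    {z : Phase N} (hz : z ∈ Φ.good) {r : ℝ} (hr : 0 < r) (hr2 : r < 1 / 2)
    {T : ℝ} {u : ℝ → T3 → V3} (hu : Torus.IsSmoothSpaceTimeOn (Ico 0 T) u) {e b : ℝ} (he : 0 ≤ e) (hb : 0 ≤ b)
    (hbe : b + e < T) {χe : ℝ → ℝ} (hχ : ContinuousOn χe (Ioi 0)) {B : ℝ} (hB0 : 0 ≤ B) (hB : ∀ a, 0 < a → |χe a| ≤ B)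
    {Cu : ℝ} (hCu : 0 ≤ Cu) (hut : ∀ s ∈ Icc 0 (b + e), ∀ x, ‖Torus.timeDerivWithin (Ico 0 T) u s x‖ ≤ Cu)
    (hD : ∀ s ∈ Icc 0 (b + e), ∀ x, ∀ i j : Fin 3, |Torus.partialDeriv j (fun y => u s y i) x| ≤ Cu)
    {ω : ℝ} (hω : 0 ≤ ω) (hωu : ∀ s ∈ Icc 0 b, ∀ x, ‖u (s + e) x - u s x‖ ≤ ω)
    (hωt : ∀ s ∈ Icc 0 b, ∀ x, ‖Torus.timeDerivWithin (Ico 0 T) u (s + e) x - Torus.timeDerivWithin (Ico 0 T) u s x‖ ≤ ω)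
    (hωD : ∀ s ∈ Icc 0 b, ∀ x, ∀ i j : Fin 3,
      |Torus.partialDeriv j (fun y => u (s + e) y i) x - Torus.partialDeriv j (fun y => u s y i) x| ≤ ω)
    {τ : ℝ} (hτ : τ ∈ Icc 0 b) :
    |((∫ x, ⟪u τ x, momC r (Φ.flow τ z) x⟫_ℝ) - (∫ x, ⟪u 0 x, momC r (Φ.flow 0 z) x⟫_ℝ) -
        ∫ s in Icc 0 τ, ∫ x, (⟪Torus.timeDerivWithin (Ico 0 T) u s x, momC r (Φ.flow s z) x⟫_ℝ +
          ∑ i : Fin 3, ∑ j : Fin 3, Torus.partialDeriv j (fun y => u s y i) x *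
            (momC r (Φ.flow s z) x i * momC r (Φ.flow s z) x j / rhoC r (Φ.flow s z) x +
              if i = j then rhoC r (Φ.flow s z) x * thetaC r (Φ.flow s z) x * χe (rhoC r (Φ.flow s z) x) else 0))) -
      ((∫ x, ⟪u (τ + e) x, momC r (Φ.flow τ z) x⟫_ℝ) - (∫ x, ⟪u (0 + e) x, momC r (Φ.flow 0 z) x⟫_ℝ) -
        ∫ s in Icc 0 τ, ∫ x, (⟪Torus.timeDerivWithin (Ico 0 T) u (s + e) x, momC r (Φ.flow s z) x⟫_ℝ +
          ∑ i : Fin 3, ∑ j : Fin 3, Torus.partialDeriv j (fun y => u (s + e) y i) x *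
            (momC r (Φ.flow s z) x i * momC r (Φ.flow s z) x j / rhoC r (Φ.flow s z) x +
              if i = j then rhoC r (Φ.flow s z) x * thetaC r (Φ.flow s z) x * χe (rhoC r (Φ.flow s z) x) else 0)))| ≤
      ω * ((1 + 2 * ke z) + b * ((7 + 2 * B) * ke z + 1 / 2)) := by
  have hke : ∀ s, ke (Φ.flow s z) = ke z := fun s => ke_flow_eq Φ hz s
  have hke0 : 0 ≤ ke z := ke_nonneg z
  have hτT : ∀ s ∈ Icc 0 b, s ∈ Ico 0 T := fun s hs => ⟨hs.1, by linarith [hs.2]⟩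
  have hτT' : ∀ s ∈ Icc 0 b, s + e ∈ Ico 0 T := fun s hs => ⟨by linarith [hs.1], by linarith [hs.2]⟩
  -- the two pairings
  have hp1 := abs_integral_inner_sub_le hr hr2 (Φ.flow τ z) ((hu.isSmooth_slice (hτT τ hτ)).continuous)
    ((hu.isSmooth_slice (hτT' τ hτ)).continuous) hω (fun x => by rw [norm_sub_rev]; exact hωu τ hτ x)
  have hp0 := abs_integral_inner_sub_le hr hr2 (Φ.flow 0 z) ((hu.isSmooth_slice (hτT 0 ⟨le_rfl, hb⟩)).continuous)
    ((hu.isSmooth_slice (hτT' 0 ⟨le_rfl, hb⟩)).continuous) hω (fun x => by rw [norm_sub_rev]; exact hωu 0 ⟨le_rfl, hb⟩ x)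
  rw [hke τ] at hp1; rw [hke 0] at hp0
  -- the factors of both flux integrands (shift `e` and shift `0`)
  obtain ⟨mρ, mm, -, mk, -, mθ, mχ⟩ := orbit_factors Φ hz hr hχ
  obtain ⟨-, -, cut1, cD1⟩ := velocity_factors hu he hbe
  obtain ⟨-, -, cut0, cD0⟩ := velocity_factors hu le_rfl (by linarith : b + 0 < T)
  simp only [add_zero] at cut0 cD0
  -- strip measurability of the difference integrand
  have hs1 := aemeasurable_flux_recipe (ν := (volume.restrict (Icc 0 b)).prod volume)
    (classical_factor cut1).1.aemeasurable mm.aemeasurable (fun i j => (classical_factor (cD1 i j)).1.aemeasurable)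
    mρ.aemeasurable mθ.aemeasurable mχ.aemeasurable
  have hs0 := aemeasurable_flux_recipe (ν := (volume.restrict (Icc 0 b)).prod volume)
    (classical_factor cut0).1.aemeasurable mm.aemeasurable (fun i j => (classical_factor (cD0 i j)).1.aemeasurable)
    mρ.aemeasurable mθ.aemeasurable mχ.aemeasurable
  have hx1 : ∀ s ∈ Icc 0 b, _ := fun s hs => aemeasurable_flux_recipe (ν := (volume : Measure T3))
    ((classical_factor cut1).2 s hs).measurable.aemeasurable (orbit_factor mm b |>.2 s).aemeasurable
    (fun i j => ((classical_factor (cD1 i j)).2 s hs).measurable.aemeasurable) (orbit_factor mρ b |>.2 s).aemeasurable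
    (orbit_factor mθ b |>.2 s).aemeasurable (orbit_factor mχ b |>.2 s).aemeasurable
  have hx0 : ∀ s ∈ Icc 0 b, _ := fun s hs => aemeasurable_flux_recipe (ν := (volume : Measure T3))
    ((classical_factor cut0).2 s hs).measurable.aemeasurable (orbit_factor mm b |>.2 s).aemeasurable
    (fun i j => ((classical_factor (cD0 i j)).2 s hs).measurable.aemeasurable) (orbit_factor mρ b |>.2 s).aemeasurable
    (orbit_factor mθ b |>.2 s).aemeasurable (orbit_factor mχ b |>.2 s).aemeasurable
  -- kinetic domination of each integrand (compare with the zero data) and of their difference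
  have hzero : ∀ (w : Phase N) (x : T3), ⟪(0 : V3), momC r w x⟫_ℝ + ∑ i : Fin 3, ∑ j : Fin 3,
      (0 : Fin 3 → Fin 3 → ℝ) i j * (momC r w x i * momC r w x j / rhoC r w x +
        if i = j then rhoC r w x * thetaC r w x * χe (rhoC r w x) else 0) = 0 := fun w x => by simp
  have hdom : ∀ (w : Phase N) (x : T3) (t : V3) (D : Fin 3 → Fin 3 → ℝ), ‖t‖ ≤ Cu → (∀ i j, |D i j| ≤ Cu) →
      |⟪t, momC r w x⟫_ℝ + ∑ i : Fin 3, ∑ j : Fin 3, D i j * (momC r w x i * momC r w x j / rhoC r w x +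
        if i = j then rhoC r w x * thetaC r w x * χe (rhoC r w x) else 0)| ≤
      0 + Cu * (7 + 2 * B) * kinC r w x + Cu / 2 * rhoC r w x := by
    intro w x t D ht hD
    have h := abs_flux_sub_le hr w x hCu hB0 (t₁ := t) (t₂ := 0) (by simpa using ht) (D₁ := D) (D₂ := 0)
      (fun i j => by simpa using hD i j) hB
    rwa [hzero w x, sub_zero] at h
  obtain ⟨i1, -, p1, -⟩ := spaceTime_bounds Φ hz hr hr2 hb
    (F := fun s x => ⟪Torus.timeDerivWithin (Ico 0 T) u (s + e) x, momC r (Φ.flow s z) x⟫_ℝ +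
      ∑ i : Fin 3, ∑ j : Fin 3, Torus.partialDeriv j (fun y => u (s + e) y i) x *
        (momC r (Φ.flow s z) x i * momC r (Φ.flow s z) x j / rhoC r (Φ.flow s z) x +
          if i = j then rhoC r (Φ.flow s z) x * thetaC r (Φ.flow s z) x * χe (rhoC r (Φ.flow s z) x) else 0))
    hs1.aestronglyMeasurable (fun s hs => (hx1 s hs).aestronglyMeasurable) (by positivity) (by positivity)
    (fun s hs x => hdom _ x _ _ (hut (s + e) ⟨by linarith [hs.1], by linarith [hs.2]⟩ x)
      (hD (s + e) ⟨by linarith [hs.1], by linarith [hs.2]⟩ x))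
  obtain ⟨i0, -, p0, -⟩ := spaceTime_bounds Φ hz hr hr2 hb
    (F := fun s x => ⟪Torus.timeDerivWithin (Ico 0 T) u s x, momC r (Φ.flow s z) x⟫_ℝ +
      ∑ i : Fin 3, ∑ j : Fin 3, Torus.partialDeriv j (fun y => u s y i) x *
        (momC r (Φ.flow s z) x i * momC r (Φ.flow s z) x j / rhoC r (Φ.flow s z) x +
          if i = j then rhoC r (Φ.flow s z) x * thetaC r (Φ.flow s z) x * χe (rhoC r (Φ.flow s z) x) else 0))
    hs0.aestronglyMeasurable (fun s hs => (hx0 s hs).aestronglyMeasurable) (by positivity) (by positivity)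
    (fun s hs x => hdom _ x _ _ (hut s ⟨hs.1, by linarith [hs.2]⟩ x) (hD s ⟨hs.1, by linarith [hs.2]⟩ x))
  obtain ⟨-, -, -, pd⟩ := spaceTime_bounds Φ hz hr hr2 hτ.1
    (F := fun s x => (⟪Torus.timeDerivWithin (Ico 0 T) u s x, momC r (Φ.flow s z) x⟫_ℝ +
      ∑ i : Fin 3, ∑ j : Fin 3, Torus.partialDeriv j (fun y => u s y i) x *
        (momC r (Φ.flow s z) x i * momC r (Φ.flow s z) x j / rhoC r (Φ.flow s z) x +
          if i = j then rhoC r (Φ.flow s z) x * thetaC r (Φ.flow s z) x * χe (rhoC r (Φ.flow s z) x) else 0)) -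
      (⟪Torus.timeDerivWithin (Ico 0 T) u (s + e) x, momC r (Φ.flow s z) x⟫_ℝ +
      ∑ i : Fin 3, ∑ j : Fin 3, Torus.partialDeriv j (fun y => u (s + e) y i) x *
        (momC r (Φ.flow s z) x i * momC r (Φ.flow s z) x j / rhoC r (Φ.flow s z) x +
          if i = j then rhoC r (Φ.flow s z) x * thetaC r (Φ.flow s z) x * χe (rhoC r (Φ.flow s z) x) else 0)))
    ((hs0.sub hs1).aestronglyMeasurable.mono_measure (Measure.prod_mono (Measure.restrict_mono
      (Icc_subset_Icc_right hτ.2) le_rfl) le_rfl))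
    (fun s hs => ((hx0 s ⟨hs.1, hs.2.trans hτ.2⟩).sub (hx1 s ⟨hs.1, hs.2.trans hτ.2⟩)).aestronglyMeasurable)
    (C₁ := 0) (C₂ := ω * (7 + 2 * B)) (C₃ := ω / 2) (by positivity) (by positivity)
    (fun s hs x => abs_flux_sub_le hr _ x hω hB0 (by rw [norm_sub_rev]; exact hωt s ⟨hs.1, hs.2.trans hτ.2⟩ x)
      (fun i j => by rw [abs_sub_comm]; exact hωD s ⟨hs.1, hs.2.trans hτ.2⟩ x i j) hB)
  -- the double integrals of the two flux integrands differ by the double integral of the difference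
  have hsub : Icc 0 τ ⊆ Icc 0 b := Icc_subset_Icc_right hτ.2
  have hdiff : (∫ s in Icc 0 τ, ∫ x, (⟪Torus.timeDerivWithin (Ico 0 T) u s x, momC r (Φ.flow s z) x⟫_ℝ +
        ∑ i : Fin 3, ∑ j : Fin 3, Torus.partialDeriv j (fun y => u s y i) x *
          (momC r (Φ.flow s z) x i * momC r (Φ.flow s z) x j / rhoC r (Φ.flow s z) x +
            if i = j then rhoC r (Φ.flow s z) x * thetaC r (Φ.flow s z) x * χe (rhoC r (Φ.flow s z) x) else 0))) -
      (∫ s in Icc 0 τ, ∫ x, (⟪Torus.timeDerivWithin (Ico 0 T) u (s + e) x, momC r (Φ.flow s z) x⟫_ℝ +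
        ∑ i : Fin 3, ∑ j : Fin 3, Torus.partialDeriv j (fun y => u (s + e) y i) x *
          (momC r (Φ.flow s z) x i * momC r (Φ.flow s z) x j / rhoC r (Φ.flow s z) x +
            if i = j then rhoC r (Φ.flow s z) x * thetaC r (Φ.flow s z) x * χe (rhoC r (Φ.flow s z) x) else 0))) =
      ∫ s in Icc 0 τ, ∫ x, ((⟪Torus.timeDerivWithin (Ico 0 T) u s x, momC r (Φ.flow s z) x⟫_ℝ +
        ∑ i : Fin 3, ∑ j : Fin 3, Torus.partialDeriv j (fun y => u s y i) x *
          (momC r (Φ.flow s z) x i * momC r (Φ.flow s z) x j / rhoC r (Φ.flow s z) x +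
            if i = j then rhoC r (Φ.flow s z) x * thetaC r (Φ.flow s z) x * χe (rhoC r (Φ.flow s z) x) else 0)) -
        (⟪Torus.timeDerivWithin (Ico 0 T) u (s + e) x, momC r (Φ.flow s z) x⟫_ℝ +
        ∑ i : Fin 3, ∑ j : Fin 3, Torus.partialDeriv j (fun y => u (s + e) y i) x *
          (momC r (Φ.flow s z) x i * momC r (Φ.flow s z) x j / rhoC r (Φ.flow s z) x +
            if i = j then rhoC r (Φ.flow s z) x * thetaC r (Φ.flow s z) x * χe (rhoC r (Φ.flow s z) x) else 0))) := by
    have e1 := integral_sub (μ := volume.restrict (Icc 0 τ)) (p0.mono_set hsub) (p1.mono_set hsub)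
    rw [← e1]
    refine setIntegral_congr_fun measurableSet_Icc fun s hs => ?_
    have e2 := integral_sub (i0 s (hsub hs)) (i1 s (hsub hs))
    rw [← e2]
  -- assemble
  have hτb : (τ - 0) * (0 + ω * (7 + 2 * B) * ke z + ω / 2) ≤ b * (ω * (7 + 2 * B) * ke z + ω / 2) := by
    have : 0 ≤ ω * (7 + 2 * B) * ke z + ω / 2 := by positivity
    nlinarith [hτ.1, hτ.2]
  have key : ∀ {a1 a2 b1 b2 c1 c2 : ℝ}, |a1 - a2| ≤ ω * (1 / 2 + ke z) → |b1 - b2| ≤ ω * (1 / 2 + ke z) →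
      |c1 - c2| ≤ b * (ω * (7 + 2 * B) * ke z + ω / 2) →
      |a1 - b1 - c1 - (a2 - b2 - c2)| ≤ ω * ((1 + 2 * ke z) + b * ((7 + 2 * B) * ke z + 1 / 2)) := by
    intro a1 a2 b1 b2 c1 c2 h1 h2 h3
    have e : a1 - b1 - c1 - (a2 - b2 - c2) = (a1 - a2) - (b1 - b2) - (c1 - c2) := by ring
    rw [e]
    have := abs_sub (a1 - a2 - (b1 - b2)) (c1 - c2)
    have := abs_sub (a1 - a2) (b1 - b2)
    nlinarith
  refine key hp1 hp0 ?_
  rw [hdiff]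
  exact pd.trans hτb

/-! ## §4 The registered sub-goal -/

/-- **Registered sub-goal `stub_reductionShift` (helper of `stub_kineticReduction`): the pairing of the cone
momentum with the difference of two nearby vector fields is small**, `|∫⟪a − b, m_r⟫| ≤ ω(1/2 + ke)` — the instant
terms of the shift error. [folklore] -/
theorem stub_reductionShift : ∀ {N : ℕ} {r : ℝ}, 0 < r → r < 1 / 2 → ∀ (w : Config (N + 1) (Fin 3) T3) {a b : T3 → V3}, Continuous a → Continuous b → ∀ {ω : ℝ}, 0 ≤ ω → (∀ x, ‖a x - b x‖ ≤ ω) → |(∫ x, ⟪a x, momC r w x⟫_ℝ) - ∫ x, ⟪b x, momC r w x⟫_ℝ| ≤ ω * (1 / 2 + ke w) :=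
  fun hr hr2 w _ _ ha hb _ hω hab => abs_integral_inner_sub_le hr hr2 w ha hb hω hab

end Summit.AtomisticToContinuum.HydrodynamicLimit.Theorems.ChaosClosesEulerReduction

end
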